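import Summits.CriticalPhenomena.Ising3DConformalLimit.Theorems.PrimaryAtInfinityWardToMoebiusInvMeasure
import Literature.Probability.LatticeModels.ScalingLimit

/-!
# Ward ⇒ Möbius, part 4: two Möbius words in the unit inversion, translations and a reflection

Support file for item stmt-CriticalPhenomena-5357 (`WardToMoebius`, route `PrimaryAtInfinity`,
sub-problem `Ising3DConformalLimit`).

Pointwise identities in a real inner product space `V` for the unit inversion
`ι = EuclideanGeometry.inversion 0 1` (`ι x = x/‖x‖²`), the translations `T_c` and the reflection
`ρ_u x = x − 2⟪x,u⟫u` in the hyperplane orthogonal to a unit vector `u`: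

* `ι(ι(x + u) − u) + u = ι(ρ_u x)` (the word `T_u ι T_{−u} ι T_u = ι ρ_u`, i.e. the special
  conformal transformation `ι T_{−u} ι` conjugates to the inversion-reflection), together with
  the conformal-factor bookkeeping `‖ι(x+u) − u‖ = ‖x‖ · ‖ι(x+u)‖`;
* the dilation word `T_{au} w T_{u/a} w T_{au} w = a² · id` for `w = ι ρ_u` and `a ≠ 0`
  (the `SL₂` identity `u(a) w u(a⁻¹) w u(a) w = diag(a, a⁻¹)` in the Möbius group of the
  half-planes bounded by the axis `ℝu`), together with the bookkeeping
  `‖x‖ · ‖p₁‖ · ‖p₂‖ = a⁻¹` for the three points at which `w` is applied.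

These are the finite (group-level) substitutes for the Lie-algebra relations `[K, P] ∼ D, M`
used by the `WardToMoebius` item (Di Francesco–Mathieu–Sénéchal 1997, §4.1 (4.18)–(4.21)).
We also record the elementary algebra of the reflection `ρ_u` (involutive, isometric, additive,
commuting with `ι`) and elementary facts about configurations `Fin n → ℝ³` (non-coincidence is
stable under diagonal translations and injective maps; a translation vector, resp. a unit vector,
avoiding finitely many constraints exists). Elementary; no definitions are introduced.
-/

noncomputable section

open EuclideanGeometry Real Set Function Metric Literature.Probability.LatticeModels
open scoped RealInnerProductSpace

namespace Summit.CriticalPhenomena.Ising3DConformalLimit.WardToMoebius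

variable {V : Type*} [NormedAddCommGroup V] [InnerProductSpace ℝ V]

/-! ### Linear combinations of a vector and a unit vector -/

/-- `‖α x + β u‖² = α² ‖x‖² + 2 α β ⟪x, u⟫ + β²` for a unit vector `u`. [folklore] -/
theorem norm_sq_lincomb (x : V) {u : V} (hu : ‖u‖ = 1) (α β : ℝ) :
    ‖α • x + β • u‖ ^ 2 = α ^ 2 * ‖x‖ ^ 2 + 2 * α * β * ⟪x, u⟫ + β ^ 2 := by
  rw [norm_add_sq_real, norm_smul, norm_smul, inner_smul_left, inner_smul_right, hu,
    Real.norm_eq_abs, Real.norm_eq_abs, mul_pow, mul_pow, sq_abs, sq_abs]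
  simp only [conj_trivial, mul_one, one_pow]
  ring

/-- `⟪α x + β u, u⟫ = α ⟪x, u⟫ + β` for a unit vector `u`. [folklore] -/
theorem inner_lincomb_unit (x : V) {u : V} (hu : ‖u‖ = 1) (α β : ℝ) :
    ⟪α • x + β • u, u⟫ = α * ⟪x, u⟫ + β := by
  rw [inner_add_left, inner_smul_left, inner_smul_left, real_inner_self_eq_norm_sq, hu]
  simp

/-- The unit inversion of a linear combination `p = α x + β u` (`u` a unit vector):
`ι p = (‖p‖²)⁻¹ α · x + (‖p‖²)⁻¹ β · u`. [folklore] -/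
theorem inversion_lincomb (x u : V) (α β : ℝ) :
    inversion (0 : V) 1 (α • x + β • u)
      = ((‖α • x + β • u‖ ^ 2)⁻¹ * α) • x + ((‖α • x + β • u‖ ^ 2)⁻¹ * β) • u := by
  rw [inversion_zero_one_eq, smul_add, smul_smul, smul_smul]

/-- The inversion-reflection `w = ι ρ_u` of a linear combination `p = α x + β u`:
`w p = ι (p − 2⟪p,u⟫ u) = (‖p‖²)⁻¹ α · x + (‖p‖²)⁻¹ (−(2 α ⟪x,u⟫ + β)) · u`. [folklore] -/
theorem inversion_reflect_lincomb (x : V) {u : V} (hu : ‖u‖ = 1) (α β : ℝ) :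
    inversion (0 : V) 1 (α • x + β • u - (2 * ⟪α • x + β • u, u⟫) • u)
      = ((‖α • x + β • u‖ ^ 2)⁻¹ * α) • x
        + ((‖α • x + β • u‖ ^ 2)⁻¹ * (-(2 * α * ⟪x, u⟫ + β))) • u := by
  have hp : α • x + β • u - (2 * ⟪α • x + β • u, u⟫) • u
      = α • x + (-(2 * α * ⟪x, u⟫ + β)) • u := by
    rw [inner_lincomb_unit x hu]; module
  have hnorm : ‖α • x + (-(2 * α * ⟪x, u⟫ + β)) • u‖ ^ 2 = ‖α • x + β • u‖ ^ 2 := by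
    rw [norm_sq_lincomb x hu, norm_sq_lincomb x hu]; ring
  rw [hp, inversion_lincomb x u, hnorm]

/-! ### The word `T_u ι T_{-u} ι T_u = ι ρ_u` -/

/-- For a unit vector `u` and `x` with `x ≠ 0`, `x + u ≠ 0`, put `y = ι(x + u)`. Then
`‖y − u‖² = ‖x‖² ‖y‖²`, `y ≠ 0`, `y − u ≠ 0`. [folklore] -/
theorem norm_sq_inversion_add_sub {x u : V} (hu : ‖u‖ = 1) (hxu : x + u ≠ 0) :
    ‖inversion (0 : V) 1 (x + u) - u‖ ^ 2 = ‖x‖ ^ 2 * ‖inversion (0 : V) 1 (x + u)‖ ^ 2 := by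
  have hm : ‖x + u‖ ^ 2 ≠ 0 := by positivity
  have h1 : x + u = (1 : ℝ) • x + (1 : ℝ) • u := by simp
  have hxu2 : ‖x + u‖ ^ 2 = ‖x‖ ^ 2 + 2 * ⟪x, u⟫ + 1 := by
    rw [h1, norm_sq_lincomb x hu]; ring
  rw [norm_inversion_zero_one, h1, inversion_lincomb x u, ← h1,
    show ((‖x + u‖ ^ 2)⁻¹ * 1) • x + ((‖x + u‖ ^ 2)⁻¹ * 1) • u - u
      = ((‖x + u‖ ^ 2)⁻¹ * 1) • x + ((‖x + u‖ ^ 2)⁻¹ * 1 - 1) • u by module,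
    norm_sq_lincomb x hu, inv_pow, hxu2]
  rw [hxu2] at hm
  field_simp
  ring

/-- **The word `T_u ι T_{−u} ι T_u = ι ρ_u`.** For a unit vector `u` and `x ≠ 0` with
`x + u ≠ 0`: `ι(ι(x + u) − u) + u = ι(x − 2⟪x,u⟫u)` — the special conformal transformation
`ι T_{−u} ι` conjugated by the translation `T_u` is the unit inversion followed by the reflection in
`u^⊥` (both commute). (Di Francesco–Mathieu–Sénéchal 1997, §4.1 (4.15)–(4.16).) [folklore] -/
theorem inversion_inversion_add_sub_add {x u : V} (hu : ‖u‖ = 1) (hx : x ≠ 0) (hxu : x + u ≠ 0) :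
    inversion (0 : V) 1 (inversion (0 : V) 1 (x + u) - u) + u
      = inversion (0 : V) 1 (x - (2 * ⟪x, u⟫) • u) := by
  have ht : ‖x‖ ^ 2 ≠ 0 := by positivity
  have hm : ‖x + u‖ ^ 2 ≠ 0 := by positivity
  have h1 : x + u = (1 : ℝ) • x + (1 : ℝ) • u := by simp
  have hxu2 : ‖x + u‖ ^ 2 = ‖x‖ ^ 2 + 2 * ⟪x, u⟫ + 1 := by
    rw [h1, norm_sq_lincomb x hu]; ring
  -- `y - u` as a linear combination
  have hy : inversion (0 : V) 1 (x + u) - u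
      = (‖x + u‖ ^ 2)⁻¹ • x + ((‖x + u‖ ^ 2)⁻¹ - 1) • u := by
    rw [h1, inversion_lincomb x u, ← h1]; module
  have hyn : ‖(‖x + u‖ ^ 2)⁻¹ • x + ((‖x + u‖ ^ 2)⁻¹ - 1) • u‖ ^ 2
      = ‖x‖ ^ 2 / ‖x + u‖ ^ 2 := by
    rw [norm_sq_lincomb x hu, hxu2]
    rw [hxu2] at hm
    field_simp
    ring
  rw [hy, inversion_lincomb x u, hyn]
  -- the right-hand side
  have hr : x - (2 * ⟪x, u⟫) • u = (1 : ℝ) • x + (-(2 * ⟪x, u⟫)) • u := by module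
  have hrn : ‖(1 : ℝ) • x + (-(2 * ⟪x, u⟫)) • u‖ ^ 2 = ‖x‖ ^ 2 := by
    rw [norm_sq_lincomb x hu]; ring
  rw [hr, inversion_lincomb x u, hrn]
  rw [hxu2] at hm ⊢
  have e1 : (‖x‖ ^ 2 / (‖x‖ ^ 2 + 2 * ⟪x, u⟫ + 1))⁻¹ * (‖x‖ ^ 2 + 2 * ⟪x, u⟫ + 1)⁻¹
      = (‖x‖ ^ 2)⁻¹ * 1 := by field_simp
  have e2 : (‖x‖ ^ 2 / (‖x‖ ^ 2 + 2 * ⟪x, u⟫ + 1))⁻¹ * ((‖x‖ ^ 2 + 2 * ⟪x, u⟫ + 1)⁻¹ - 1) + 1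
      = (‖x‖ ^ 2)⁻¹ * (-(2 * ⟪x, u⟫)) := by field_simp; ring
  rw [e1, ← e2]
  module

/-! ### The dilation word `T_{au} w T_{u/a} w T_{au} w = a² · id`, `w = ι ρ_u` -/

/-- **The dilation word.** For a unit vector `u`, `a ≠ 0` and `x ≠ 0`, let `w = ι ρ_u`
(`w p = ι(p − 2⟪p,u⟫u)`), `p₁ = w x + a u`, `p₂ = w p₁ + a⁻¹ u`, and assume `p₁, p₂ ≠ 0`. Then
`w p₂ + a u = a² x`, and the conformal factors satisfy `‖x‖² ‖p₁‖² ‖p₂‖² = a⁻²`. This is the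
`SL₂(ℝ)` identity `u(a) w u(a⁻¹) w u(a) w = diag(a, a⁻¹)` (acting by `z ↦ a² z`) in the Möbius
group of the half-planes bounded by the axis `ℝu`, where `T_{cu} ↦ u(c)` and `w ↦ (z ↦ −1/z)`;
it replaces the Lie-algebra relation `[K_u, P_u] = 2D` (Di Francesco–Mathieu–Sénéchal 1997,
§4.1 (4.19)–(4.20)). [folklore] -/
theorem dilation_word {x u p₁ p₂ : V} (hu : ‖u‖ = 1) {a : ℝ} (ha : a ≠ 0) (hx : x ≠ 0)
    (h₁ : p₁ = inversion (0 : V) 1 (x - (2 * ⟪x, u⟫) • u) + a • u) (hp₁ : p₁ ≠ 0)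
    (h₂ : p₂ = inversion (0 : V) 1 (p₁ - (2 * ⟪p₁, u⟫) • u) + a⁻¹ • u) :
    inversion (0 : V) 1 (p₂ - (2 * ⟪p₂, u⟫) • u) + a • u = (a ^ 2) • x ∧
      ‖x‖ ^ 2 * (‖p₁‖ ^ 2 * ‖p₂‖ ^ 2) = (a ^ 2)⁻¹ := by
  -- notation: `D = 1 - 2a⟪x,u⟫ + a²‖x‖²`, kept atomic
  obtain ⟨D, hDdef⟩ : ∃ D : ℝ, D = 1 - 2 * a * ⟪x, u⟫ + a ^ 2 * ‖x‖ ^ 2 := ⟨_, rfl⟩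
  have ht : ‖x‖ ^ 2 ≠ 0 := by positivity
  have hx1 : x = (1 : ℝ) • x + (0 : ℝ) • u := by simp
  have hxn : ‖(1 : ℝ) • x + (0 : ℝ) • u‖ ^ 2 = ‖x‖ ^ 2 := by rw [← hx1]
  -- `p₁` as a linear combination, and its norm
  have hp1 : p₁ = (‖x‖ ^ 2)⁻¹ • x + (a - 2 * ⟪x, u⟫ * (‖x‖ ^ 2)⁻¹) • u := by
    rw [h₁]
    conv_lhs => rw [hx1]
    rw [inversion_reflect_lincomb x hu, hxn]
    module
  have hn1 : ‖p₁‖ ^ 2 = D / ‖x‖ ^ 2 := by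
    rw [hp1, norm_sq_lincomb x hu, hDdef]; field_simp; ring
  have hD : D ≠ 0 := by
    intro h0
    apply hp₁
    rw [← norm_eq_zero, ← pow_eq_zero_iff two_ne_zero, hn1, h0, zero_div]
  -- `p₂` as a linear combination, and its norm
  have hp2 : p₂ = D⁻¹ • x + (a⁻¹ - a * ‖x‖ ^ 2 * D⁻¹) • u := by
    rw [h₂, hp1, inversion_reflect_lincomb x hu, ← hp1, hn1]
    have e1 : (D / ‖x‖ ^ 2)⁻¹ * (‖x‖ ^ 2)⁻¹ = D⁻¹ := by
      field_simp
    have e2 : (D / ‖x‖ ^ 2)⁻¹ * -(2 * (‖x‖ ^ 2)⁻¹ * ⟪x, u⟫ + (a - 2 * ⟪x, u⟫ * (‖x‖ ^ 2)⁻¹))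
        + a⁻¹ = a⁻¹ - a * ‖x‖ ^ 2 * D⁻¹ := by
      field_simp; ring
    rw [e1, ← e2]
    module
  have hn2 : ‖p₂‖ ^ 2 = (a ^ 2 * D)⁻¹ := by
    rw [hp2, norm_sq_lincomb x hu]
    field_simp
    rw [hDdef]
    ring
  refine ⟨?_, ?_⟩
  · rw [hp2, inversion_reflect_lincomb x hu, ← hp2, hn2]
    have e3 : (a ^ 2 * D)⁻¹⁻¹ * D⁻¹ = a ^ 2 := by
      field_simp
    have e4 : (a ^ 2 * D)⁻¹⁻¹ * -(2 * D⁻¹ * ⟪x, u⟫ + (a⁻¹ - a * ‖x‖ ^ 2 * D⁻¹)) + a = 0 := by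
      field_simp
      rw [hDdef]
      ring
    rw [e3, add_assoc, ← add_smul, e4, zero_smul, add_zero]
  · rw [hn1, hn2]; field_simp


/-! ### Configurations of points in `ℝ³` -/

section Config

variable {n : ℕ}


/-- The non-coincident configurations are stable under diagonal translations. [folklore] -/
theorem add_const_mem_nonCoincident {x : Fin n → EuclideanSpace ℝ (Fin 3)}
    (hx : x ∈ NonCoincident 3 n) (v : EuclideanSpace ℝ (Fin 3)) :
    (fun i => x i + v) ∈ NonCoincident 3 n := by
  simp only [mem_nonCoincident] at hx ⊢
  intro i j h
  exact hx (add_right_cancel h)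

/-- Post-composition with an injective map preserves non-coincidence. [folklore] -/
theorem comp_mem_nonCoincident {x : Fin n → EuclideanSpace ℝ (Fin 3)}
    (hx : x ∈ NonCoincident 3 n) {f : EuclideanSpace ℝ (Fin 3) → EuclideanSpace ℝ (Fin 3)}
    (hf : Injective f) : (fun i => f (x i)) ∈ NonCoincident 3 n := by
  simp only [mem_nonCoincident] at hx ⊢
  exact hf.comp hx

/-- Post-composition with an injective map reflects non-coincidence. [folklore] -/
theorem mem_nonCoincident_of_comp {x : Fin n → EuclideanSpace ℝ (Fin 3)}
    {f : EuclideanSpace ℝ (Fin 3) → EuclideanSpace ℝ (Fin 3)}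
    (hx : (fun i => f (x i)) ∈ NonCoincident 3 n) : x ∈ NonCoincident 3 n := by
  simp only [mem_nonCoincident] at hx ⊢
  exact Injective.of_comp hx

/-- The open set `U₀` of non-coincident configurations avoiding the origin is open. [folklore] -/
theorem isOpen_U0 :
    IsOpen {x : Fin n → EuclideanSpace ℝ (Fin 3) | x ∈ NonCoincident 3 n ∧ ∀ i, x i ≠ 0} :=
  (isOpen_nonCoincident 3 n).inter isOpen_forall_ne_zero

/-- There is a translation vector moving finitely many points off any finite set. [folklore] -/
theorem exists_forall_add_notMem (x : Fin n → EuclideanSpace ℝ (Fin 3))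
    {B : Set (EuclideanSpace ℝ (Fin 3))} (hB : B.Finite) :
    ∃ v : EuclideanSpace ℝ (Fin 3), ∀ i, x i + v ∉ B := by
  have hbad : (⋃ i, (fun b => b - x i) '' B).Finite := finite_iUnion fun i => hB.image _
  obtain ⟨v, -, hv⟩ := Set.infinite_univ.exists_notMem_finset hbad.toFinset
  refine ⟨v, fun i hi => hv ?_⟩
  simp only [Finite.mem_toFinset, mem_iUnion, mem_image]
  exact ⟨i, x i + v, hi, by abel⟩

/-- There is a unit vector `u` with `xᵢ + u ≠ 0` for finitely many given points `xᵢ` (the unit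
sphere of `ℝ³` is infinite). [folklore] -/
theorem exists_unit_forall_add_ne_zero (x : Fin n → EuclideanSpace ℝ (Fin 3)) :
    ∃ u : EuclideanSpace ℝ (Fin 3), ‖u‖ = 1 ∧ ∀ i, x i + u ≠ 0 := by
  have hrank : 1 < Module.rank ℝ (EuclideanSpace ℝ (Fin 3)) := by
    rw [← Module.finrank_eq_rank, finrank_euclideanSpace, Fintype.card_fin]; norm_num
  set e : EuclideanSpace ℝ (Fin 3) := EuclideanSpace.single 0 1 with he
  have he1 : ‖e‖ = 1 := (EuclideanSpace.orthonormal_single (𝕜 := ℝ) (ι := Fin 3)).1 0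
  have hinf : (sphere (0 : EuclideanSpace ℝ (Fin 3)) 1).Infinite := by
    refine (isPreconnected_sphere hrank 0 1).infinite_of_nontrivial ⟨e, ?_, -e, ?_, ?_⟩
    · simpa using he1
    · simpa using he1
    · intro h
      have : (2 : ℝ) • e = 0 := by rw [two_smul]; nth_rewrite 2 [h]; exact add_neg_cancel e
      rw [smul_eq_zero] at this
      rcases this with h2 | h0
      · norm_num at h2
      · rw [h0, norm_zero] at he1; norm_num at he1
  have hbad : (Set.range fun i => -x i).Finite := finite_range _
  obtain ⟨u, hu, hu'⟩ := hinf.exists_notMem_finset hbad.toFinset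
  refine ⟨u, by simpa using hu, fun i hi => hu' ?_⟩
  simp only [Finite.mem_toFinset, mem_range]
  exact ⟨i, by rw [← sub_eq_zero, ← neg_add', hi, neg_zero]⟩

/-! ### The reflection `ρ_u x = x − 2⟪x,u⟫u` in the hyperplane orthogonal to a unit vector -/

section Reflection

/-- `ρ_u` is an involution. [folklore] -/
theorem reflect_reflect (x : V) {u : V} (hu : ‖u‖ = 1) :
    (x - (2 * ⟪x, u⟫) • u) - (2 * ⟪x - (2 * ⟪x, u⟫) • u, u⟫) • u = x := by
  rw [inner_sub_left, inner_smul_left, real_inner_self_eq_norm_sq, hu]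
  simp only [conj_trivial, one_pow, mul_one]
  module

/-- `ρ_u` is injective. [folklore] -/
theorem reflect_injective {u : V} (hu : ‖u‖ = 1) :
    Injective fun x : V => x - (2 * ⟪x, u⟫) • u := fun x y h => by
  have := congrArg (fun z : V => z - (2 * ⟪z, u⟫) • u) h
  simpa only [reflect_reflect _ hu] using this

/-- `ρ_u` preserves norms. [folklore] -/
theorem norm_reflect (x : V) {u : V} (hu : ‖u‖ = 1) : ‖x - (2 * ⟪x, u⟫) • u‖ = ‖x‖ := by
  have h : ‖x - (2 * ⟪x, u⟫) • u‖ ^ 2 = ‖x‖ ^ 2 := by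
    rw [show x - (2 * ⟪x, u⟫) • u = (1 : ℝ) • x + (-(2 * ⟪x, u⟫)) • u by module,
      norm_sq_lincomb x hu]
    ring
  exact (pow_left_inj₀ (norm_nonneg _) (norm_nonneg _) two_ne_zero).1 h

/-- `ρ_u` is additive: `ρ_u (x + v) = ρ_u x + ρ_u v`. [folklore] -/
theorem reflect_add (x v u : V) :
    (x + v) - (2 * ⟪x + v, u⟫) • u = (x - (2 * ⟪x, u⟫) • u) + (v - (2 * ⟪v, u⟫) • u) := by
  rw [inner_add_left]; module

/-- `ρ_u (−u) = u`. [folklore] -/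
theorem reflect_neg_self {u : V} (hu : ‖u‖ = 1) : (-u) - (2 * ⟪-u, u⟫) • u = u := by
  rw [inner_neg_left, real_inner_self_eq_norm_sq, hu]; module

/-- The unit inversion commutes with `ρ_u`. [folklore] -/
theorem inversion_reflect_comm (x : V) {u : V} (hu : ‖u‖ = 1) :
    inversion (0 : V) 1 (x - (2 * ⟪x, u⟫) • u)
      = inversion (0 : V) 1 x - (2 * ⟪inversion (0 : V) 1 x, u⟫) • u := by
  rw [inversion_zero_one_eq, inversion_zero_one_eq, norm_reflect x hu, inner_smul_left]
  simp only [conj_trivial]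
  rw [smul_sub, smul_smul]
  module

end Reflection

end Config

end Summit.CriticalPhenomena.Ising3DConformalLimit.WardToMoebius
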